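import Summits.KontsevichZagierPeriods.KontsevichZagierPeriods.Theorems.RootDecompQuadraticDescentGoldenPairP4

/-!
# DARK census pair #10 `[□²,1/(1−x+y+x²−y²)] ≡ 2·[□²,1/(1+y+2xy+y²)]` DECIDED in `KZ.relations` by rules 1+2 (route `RootDecompQuadraticDescent`, instance of crux stmt-KontsevichZagierPeriods-28994 `DescentTwoQ` / stmt-4280 `KZDimTwo`) · part 5/6

Cell `decomp-kz`, lens 6 (decomp-kz-lens-6 g8e): `pair10` — the golden-ratio dilogarithm pair of the weight-2 box census, decided with ℚ-data only (no power map, no Landen, no irrational cut); packaged `goldenPair_descentTwoQ_instance` (∀ R ⊇ relations) and `goldenPair_of_kzDimTwo` BY NAME over the born `KZDimTwo`; imports the LANDED `…DarkPairsEleven` reflection kit.  After this, the weight-2 box census has ONE open row (#18).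

Source: `HOME/decomp-kz-lens-6/g8/GoldenPair10.lean` sha256 3ad60a9384e30dab (1472 l; critic decomp-kz-crit-1 g2 CLEARED/kernel-confirmed 2026-08-30T10:32:33Z, std axioms), split into 6 modules by the landing seat decomp-kz-census-1 g7 (contexts re-opened per part; generic docstrings added where the source had none; the route file is imported only by the last part).  No `sorry`; standard axioms.  References: [cite: KontsevichZagier2001, §1.2].
-/

noncomputable section

open MeasureTheory Set MvPolynomial

namespace Summit.KontsevichZagierPeriods.RootDecompQuadraticDescent.GoldenPair

open Literature.NumberTheory.Transcendental
open Literature.NumberTheory.Transcendental.KZ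
open Literature.ModelTheory.ExponentialFields (IsSemialgebraic continuous_aeval_real)
open Summit.KontsevichZagierPeriods.RootDecompQuadraticDescent.DarkPairs (rel_reflect_rep rel_double
  update_one_apply_zero one_div_eq_mul_one_div)

-- PRIVATE copy (landed twin elsewhere; dedup.landed): snoc2_zero, snoc2_one, init2_zero
/-- `snoc2_zero`: auxiliary theorem of the lens-6 g8e development GoldenPair10 (census pair #10; instances of 28994/4280) — see the module docstring; verbatim from the lens file. -/
@[simp] private theorem snoc2_zero (x : Fin 1 → ℝ) (t : ℝ) : (Fin.snoc x t : Fin 2 → ℝ) 0 = x 0 := rfl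

/-- `snoc2_one`: auxiliary theorem of the lens-6 g8e development GoldenPair10 (census pair #10; instances of 28994/4280) — see the module docstring; verbatim from the lens file. -/
@[simp] private theorem snoc2_one (x : Fin 1 → ℝ) (t : ℝ) : (Fin.snoc x t : Fin 2 → ℝ) 1 = t := rfl

/-- `init2_zero`: auxiliary theorem of the lens-6 g8e development GoldenPair10 (census pair #10; instances of 28994/4280) — see the module docstring; verbatim from the lens file. -/
@[simp] private theorem init2_zero (z : Fin 2 → ℝ) : Fin.init z 0 = z 0 := rfl

/-- **Affine substitution in the plane.**  `Φ(z) = M z + v` with `M ∈ GL₂(ℚ)`: if `Φ` maps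
`r.domain` onto `r'.domain` and `f = (f' ∘ Φ)·|det M|` on `r.domain`, then `[r] − [r'] ∈ KZ.relations`.
[cite: KontsevichZagier2001, §1.2 rule 2] -/
theorem rel_affine (r r' : KZ.IntegralRep 2) (M : Matrix (Fin 2) (Fin 2) ℚ) (v : Fin 2 → ℚ)
    (Φ : (Fin 2 → ℝ) → (Fin 2 → ℝ))
    (hΦ : ∀ z i, Φ z i = (M i 0 : ℝ) * z 0 + (M i 1 : ℝ) * z 1 + (v i : ℝ))
    (hdet : M.det ≠ 0) (himg : r'.domain = Φ '' r.domain)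
    (hint : ∀ z ∈ r.domain, r.integrand z = r'.integrand (Φ z) * |(M.det : ℝ)|) :
    KZ.of r - KZ.of r' ∈ KZ.relations := by
  let Mr : Matrix (Fin 2) (Fin 2) ℝ := fun i j => (M i j : ℝ)
  let Lr : (Fin 2 → ℝ) →ₗ[ℝ] (Fin 2 → ℝ) := Matrix.toLin' Mr
  let Φ' : (Fin 2 → ℝ) → (Fin 2 → ℝ) →L[ℝ] (Fin 2 → ℝ) := fun _ => LinearMap.toContinuousLinearMap Lr
  have hLr : ∀ z, Lr z = fun i => (M i 0 : ℝ) * z 0 + (M i 1 : ℝ) * z 1 := by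
    intro z; funext i
    simp [Lr, Mr, Matrix.toLin'_apply, Matrix.mulVec, dotProduct, Fin.sum_univ_two]
  have hΦL : Φ = fun z => Lr z + fun i => (v i : ℝ) := by
    funext z; funext i
    rw [hΦ, Pi.add_apply, hLr]
  have hdetR : Mr.det = (M.det : ℝ) := by
    rw [Matrix.det_fin_two, Matrix.det_fin_two]; push_cast; simp [Mr]
  have hdet' : ∀ z, (Φ' z).det = (M.det : ℝ) := by
    intro z
    rw [← hdetR]
    unfold ContinuousLinearMap.det
    simp [Φ', Lr, LinearMap.det_toLin']
  have hdetR' : ((M 0 0 * M 1 1 - M 0 1 * M 1 0 : ℚ) : ℝ) ≠ 0 := by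
    rw [← Matrix.det_fin_two]; exact_mod_cast hdet
  refine KZ.changeOfVariablesRel_subset_relations ⟨2, r, r', Φ, Φ', ?_, ?_, ?_, himg, ?_, rfl⟩
  · refine (isSemialgebraicMapOn_iff_forall_holds r.isSemialgebraic_domain).mpr fun i => ?_
    exact (isSemialgebraicFunOn_aeval r.isSemialgebraic_domain
      (C (M i 0) * X 0 + C (M i 1) * X 1 + C (v i))).congr fun z _ => by
        simp only [map_add, map_mul, aeval_C, aeval_X, eq_ratCast, hΦ]
  · intro z _
    rw [hΦL]
    have h := ((LinearMap.toContinuousLinearMap Lr).hasFDerivAt (x := z)).add_const (fun i => (v i : ℝ))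
    simpa [Φ'] using h.hasFDerivWithinAt
  · intro z₁ _ z₂ _ h
    have e1 := congrFun h 0
    have e2 := congrFun h 1
    simp only [hΦ] at e1 e2
    have hx : ((M 0 0 * M 1 1 - M 0 1 * M 1 0 : ℚ) : ℝ) * (z₁ 0 - z₂ 0) = 0 := by
      push_cast; linear_combination (M 1 1 : ℝ) * e1 - (M 0 1 : ℝ) * e2
    have hy : ((M 0 0 * M 1 1 - M 0 1 * M 1 0 : ℚ) : ℝ) * (z₁ 1 - z₂ 1) = 0 := by
      push_cast; linear_combination (M 0 0 : ℝ) * e2 - (M 1 0 : ℝ) * e1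
    rcases mul_eq_zero.1 hx with h1 | h1
    · exact absurd h1 hdetR'
    rcases mul_eq_zero.1 hy with h2 | h2
    · exact absurd h2 hdetR'
    funext i
    fin_cases i
    · exact sub_eq_zero.1 h1
    · exact sub_eq_zero.1 h2
  · intro z hz
    rw [hint z hz, hdet' z]

/-! ### The pieces and the four affine maps -/

/-- `QA`: auxiliary def of the lens-6 g8e development GoldenPair10 (census pair #10; instances of 28994/4280) — see the module docstring; verbatim from the lens file. -/
def QA : MvPolynomial (Fin 2) ℚ := 1 - X 0 + X 1 + X 0 ^ 2 - X 1 ^ 2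
/-- `PH`: auxiliary def of the lens-6 g8e development GoldenPair10 (census pair #10; instances of 28994/4280) — see the module docstring; verbatim from the lens file. -/
def PH (c : ℚ) : MvPolynomial (Fin 2) ℚ := 2 + 2 * C c * X 0 * X 1

/-- `QA_pos`: auxiliary theorem of the lens-6 g8e development GoldenPair10 (census pair #10; instances of 28994/4280) — see the module docstring; verbatim from the lens file. -/
private theorem QA_pos {x : Fin 2 → ℝ} (hx : x ∈ cube 2) : 0 < aeval x QA := by
  have h0 := (hx 0).1; have h0' := (hx 0).2; have h1 := (hx 1).1; have h1' := (hx 1).2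
  simp only [QA, map_add, map_sub, map_pow, map_one, aeval_X]
  nlinarith [sq_nonneg (x 0 - 1 / 2), mul_nonneg h1 (sub_nonneg.2 h1')]

/-- `PH_ge`: auxiliary theorem of the lens-6 g8e development GoldenPair10 (census pair #10; instances of 28994/4280) — see the module docstring; verbatim from the lens file. -/
private theorem PH_ge {c : ℚ} (hc : -1 ≤ c ∧ c ≤ 1) {z : Fin 2 → ℝ} (hz : z ∈ sbDom zeroE omE) :
    (3 / 2 : ℝ) ≤ aeval z (PH c) := by
  have h := PΔ_ge hc hz
  simp only [PΔ, map_add, map_mul, map_one, aeval_C, aeval_X, eq_ratCast] at h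
  simp only [PH, map_add, map_mul, map_ofNat, aeval_C, aeval_X, eq_ratCast]
  linarith

/-- Census row #10, A-side: `A10 = [□², dx dy/(1 − x + y + x² − y²)]`; the half-integrand triangle
forms `H(c) = [Δ, 1/(2(1 + c w v))]`. -/
def A10 : RFun 2 := ⟨1, QA, fun _ hx => (QA_pos hx).ne'⟩
/-- `H`: auxiliary def of the lens-6 g8e development GoldenPair10 (census pair #10; instances of 28994/4280) — see the module docstring; verbatim from the lens file. -/
def H (c : ℚ) (hc : -1 ≤ c ∧ c ≤ 1) : KZ.IntegralRep 2 :=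
  BRq zeroE omE 1 (PH c) (3 / 2) 1 (by norm_num) (fun _ hz => PH_ge hc hz) fun z _ => abs_aeval_one_le z

/-- `hA10`: auxiliary theorem of the lens-6 g8e development GoldenPair10 (census pair #10; instances of 28994/4280) — see the module docstring; verbatim from the lens file. -/
private theorem hA10 : A10.rep.domain = sbDom zeroE oneE := by rw [RFun.rep_domain, cube_eq_sbDom]
/-- `zero_le_mn`: auxiliary theorem of the lens-6 g8e development GoldenPair10 (census pair #10; instances of 28994/4280) — see the module docstring; verbatim from the lens file. -/
private theorem zero_le_mn : ∀ t ∈ Icc (0 : ℝ) 1, zeroE.f t ≤ mnE.f t := fun t ht => by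
  simp only [zeroE_f, mnE_f]; exact le_min ht.1 (by linarith [ht.2])
/-- `mn_le_one`: auxiliary theorem of the lens-6 g8e development GoldenPair10 (census pair #10; instances of 28994/4280) — see the module docstring; verbatim from the lens file. -/
private theorem mn_le_one : ∀ t ∈ Icc (0 : ℝ) 1, mnE.f t ≤ oneE.f t := fun t ht => by
  simp only [oneE_f, mnE_f]; exact min_le_of_left_le ht.2
/-- `mn_le_mx`: auxiliary theorem of the lens-6 g8e development GoldenPair10 (census pair #10; instances of 28994/4280) — see the module docstring; verbatim from the lens file. -/
private theorem mn_le_mx : ∀ t ∈ Icc (0 : ℝ) 1, mnE.f t ≤ mxE.f t := fun t _ => by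
  simp only [mnE_f, mxE_f]; exact min_le_max
/-- `mx_le_one`: auxiliary theorem of the lens-6 g8e development GoldenPair10 (census pair #10; instances of 28994/4280) — see the module docstring; verbatim from the lens file. -/
private theorem mx_le_one : ∀ t ∈ Icc (0 : ℝ) 1, mxE.f t ≤ oneE.f t := fun t ht => by
  simp only [oneE_f, mxE_f]; exact max_le ht.2 (by linarith [ht.1])

/-- The pieces: `Bot` (below both diagonals), `Rest`, `Mid = Left ∪ Right`, `Top`, `MidL`, `MidR`. -/
def Bot : KZ.IntegralRep 2 := loP A10.rep zeroE mnE oneE hA10 mn_le_one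
/-- `Rest`: auxiliary def of the lens-6 g8e development GoldenPair10 (census pair #10; instances of 28994/4280) — see the module docstring; verbatim from the lens file. -/
def Rest : KZ.IntegralRep 2 := hiP A10.rep zeroE mnE oneE hA10 zero_le_mn
/-- `Mid`: auxiliary def of the lens-6 g8e development GoldenPair10 (census pair #10; instances of 28994/4280) — see the module docstring; verbatim from the lens file. -/
def Mid : KZ.IntegralRep 2 := loP Rest mnE mxE oneE rfl mx_le_one
/-- `Top`: auxiliary def of the lens-6 g8e development GoldenPair10 (census pair #10; instances of 28994/4280) — see the module docstring; verbatim from the lens file. -/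
def Top : KZ.IntegralRep 2 := hiP Rest mnE mxE oneE rfl mn_le_mx
/-- `MidL`: auxiliary def of the lens-6 g8e development GoldenPair10 (census pair #10; instances of 28994/4280) — see the module docstring; verbatim from the lens file. -/
def MidL : KZ.IntegralRep 2 := GB Mid mnE mxE rfl 0 (1 / 2) le_rfl (by norm_num)
/-- `MidR`: auxiliary def of the lens-6 g8e development GoldenPair10 (census pair #10; instances of 28994/4280) — see the module docstring; verbatim from the lens file. -/
def MidR : KZ.IntegralRep 2 := GB Mid mnE mxE rfl (1 / 2) 1 (by norm_num) le_rfl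

/-- `d1`: auxiliary theorem of the lens-6 g8e development GoldenPair10 (census pair #10; instances of 28994/4280) — see the module docstring; verbatim from the lens file. -/
theorem d1 : KZ.of A10.rep - KZ.of Bot - KZ.of Rest ∈ KZ.relations :=
  br_cut A10.rep zeroE mnE oneE hA10 zero_le_mn mn_le_one
/-- `d2`: auxiliary theorem of the lens-6 g8e development GoldenPair10 (census pair #10; instances of 28994/4280) — see the module docstring; verbatim from the lens file. -/
theorem d2 : KZ.of Rest - KZ.of Mid - KZ.of Top ∈ KZ.relations :=
  br_cut Rest mnE mxE oneE rfl mn_le_mx mx_le_one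
/-- `d3`: auxiliary theorem of the lens-6 g8e development GoldenPair10 (census pair #10; instances of 28994/4280) — see the module docstring; verbatim from the lens file. -/
theorem d3 : KZ.of Mid - KZ.of MidL - KZ.of MidR ∈ KZ.relations :=
  gcut Mid mnE mxE rfl (1 / 2) (by norm_num) (by norm_num)

/-- The integrand identity behind all four maps: `Q_A = 1 + (x − y)(x + y − 1)`. -/
private theorem A10_integrand (z : Fin 2 → ℝ) : A10.rep.integrand z =
    1 / (1 + (z 0 - z 1) * (z 0 + z 1 - 1)) := by
  rw [RFun.rep_integrand]
  simp only [RFun.fn, A10, QA, map_add, map_sub, map_pow, map_one, aeval_X]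
  congr 1; ring

/-- `A10_den_pos`: auxiliary theorem of the lens-6 g8e development GoldenPair10 (census pair #10; instances of 28994/4280) — see the module docstring; verbatim from the lens file. -/
private theorem A10_den_pos {z : Fin 2 → ℝ} (hz : z ∈ cube 2) : 0 < 1 + (z 0 - z 1) * (z 0 + z 1 - 1) := by
  have h := QA_pos hz
  simp only [QA, map_add, map_sub, map_pow, map_one, aeval_X] at h
  nlinarith [h]

/-- `H_integrand`: auxiliary theorem of the lens-6 g8e development GoldenPair10 (census pair #10; instances of 28994/4280) — see the module docstring; verbatim from the lens file. -/
private theorem H_integrand (c : ℚ) (hc : -1 ≤ c ∧ c ≤ 1) (w : Fin 2 → ℝ) :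
    (H c hc).integrand w = 1 / (2 + 2 * (c : ℝ) * w 0 * w 1) := by
  simp only [H, BRq_integrand, PH, map_add, map_mul, map_ofNat, map_one, aeval_C, aeval_X, eq_ratCast]

/-- `mem_H_domain`: auxiliary theorem of the lens-6 g8e development GoldenPair10 (census pair #10; instances of 28994/4280) — see the module docstring; verbatim from the lens file. -/
private theorem mem_H_domain {c : ℚ} {hc : -1 ≤ c ∧ c ≤ 1} {w : Fin 2 → ℝ} :
    w ∈ (H c hc).domain ↔ (0 ≤ w 0 ∧ w 0 ≤ 1) ∧ 0 ≤ w 1 ∧ w 1 ≤ 1 - w 0 := by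
  show w ∈ sbDom zeroE omE ↔ _
  rw [mem_sbDom, zeroE_f, omE_f]

/-- The final arithmetic of each map: `1/A = (1/B)·2` when `B = 2A`. -/
private theorem inv_eq_inv_mul_two {A B : ℝ} (hA : 0 < A) (hB : B = 2 * A) : 1 / A = 1 / B * 2 := by
  rw [hB]; field_simp

/-- (d4) `Bot ≡ H(−1)` by `(x, y) ↦ (x − y, 1 − x − y)`. -/
theorem d4 : KZ.of Bot - KZ.of (H (-1) (by norm_num)) ∈ KZ.relations := by
  refine rel_affine Bot (H (-1) (by norm_num)) !![1, -1; -1, -1] ![0, 1]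
    (fun z => ![z 0 - z 1, 1 - z 0 - z 1]) (fun z i => by fin_cases i <;> simp <;> ring)
    (by rw [Matrix.det_fin_two_of]; norm_num) ?_ fun z hz => ?_
  · ext w
    rw [mem_H_domain]
    simp only [mem_image, Bot, loP_domain, mem_sbDom, zeroE_f, mnE_f, le_min_iff]
    constructor
    · rintro ⟨⟨h0, h0'⟩, h1, h2⟩
      refine ⟨![(w 0 - w 1 + 1) / 2, (1 - w 0 - w 1) / 2], ?_, ?_⟩
      · simp only [Matrix.cons_val_zero, Matrix.cons_val_one]
        refine ⟨⟨?_, ?_⟩, ?_, ?_, ?_⟩ <;> linarith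
      · funext i; fin_cases i <;> simp <;> ring
    · rintro ⟨z, ⟨⟨h0, h0'⟩, h1, h2, h3⟩, rfl⟩
      simp only [Matrix.cons_val_zero, Matrix.cons_val_one]
      refine ⟨⟨?_, ?_⟩, ?_, ?_⟩ <;> linarith
  · have hz' := hz
    simp only [Bot, loP_domain, mem_sbDom, zeroE_f, mnE_f, le_min_iff] at hz'
    have hA := A10_den_pos (z := z) (by
      rw [cube_eq_sbDom, mem_sbDom, zeroE_f, oneE_f]
      exact ⟨hz'.1, hz'.2.1, by linarith [hz'.2.2.2, hz'.1.1]⟩)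
    have habs : |((!![1, -1; -1, -1] : Matrix (Fin 2) (Fin 2) ℚ).det : ℝ)| = 2 := by
      rw [Matrix.det_fin_two_of]; norm_num
    rw [habs, Bot, loP_integrand, A10_integrand, H_integrand]
    simp only [Matrix.cons_val_zero, Matrix.cons_val_one]
    exact inv_eq_inv_mul_two hA (by push_cast; ring)

/-- (d5) `Top ≡ H(−1)` by `(x, y) ↦ (y − x, x + y − 1)`. -/
theorem d5 : KZ.of Top - KZ.of (H (-1) (by norm_num)) ∈ KZ.relations := by
  refine rel_affine Top (H (-1) (by norm_num)) !![-1, 1; 1, 1] ![0, -1]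
    (fun z => ![z 1 - z 0, z 0 + z 1 - 1]) (fun z i => by fin_cases i <;> simp <;> ring)
    (by rw [Matrix.det_fin_two_of]; norm_num) ?_ fun z hz => ?_
  · ext w
    rw [mem_H_domain]
    simp only [mem_image, Top, Rest, hiP_domain, mem_sbDom, oneE_f, mxE_f, max_le_iff]
    constructor
    · rintro ⟨⟨h0, h0'⟩, h1, h2⟩
      refine ⟨![(w 1 - w 0 + 1) / 2, (w 0 + w 1 + 1) / 2], ?_, ?_⟩
      · simp only [Matrix.cons_val_zero, Matrix.cons_val_one]
        refine ⟨⟨?_, ?_⟩, ⟨?_, ?_⟩, ?_⟩ <;> linarith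
      · funext i; fin_cases i <;> simp <;> ring
    · rintro ⟨z, ⟨⟨h0, h0'⟩, ⟨h1, h2⟩, h3⟩, rfl⟩
      simp only [Matrix.cons_val_zero, Matrix.cons_val_one]
      refine ⟨⟨?_, ?_⟩, ?_, ?_⟩ <;> linarith
  · have hz' := hz
    simp only [Top, Rest, hiP_domain, mem_sbDom, oneE_f, mxE_f, max_le_iff] at hz'
    have hA := A10_den_pos (z := z) (by
      rw [cube_eq_sbDom, mem_sbDom, zeroE_f, oneE_f]
      exact ⟨hz'.1, by linarith [hz'.2.1.1, hz'.1.1], hz'.2.2⟩)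
    have habs : |((!![-1, 1; 1, 1] : Matrix (Fin 2) (Fin 2) ℚ).det : ℝ)| = 2 := by
      rw [Matrix.det_fin_two_of]; norm_num
    rw [habs, Top, hiP_integrand, Rest, hiP_integrand, A10_integrand, H_integrand]
    simp only [Matrix.cons_val_zero, Matrix.cons_val_one]
    exact inv_eq_inv_mul_two hA (by push_cast; ring)

/-- (d6) `MidL ≡ H(1)` by `(x, y) ↦ (y − x, 1 − x − y)`. -/
theorem d6 : KZ.of MidL - KZ.of (H 1 (by norm_num)) ∈ KZ.relations := by
  refine rel_affine MidL (H 1 (by norm_num)) !![-1, 1; -1, -1] ![0, 1]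
    (fun z => ![z 1 - z 0, 1 - z 0 - z 1]) (fun z i => by fin_cases i <;> simp <;> ring)
    (by rw [Matrix.det_fin_two_of]; norm_num) ?_ fun z hz => ?_
  · ext w
    rw [mem_H_domain]
    simp only [mem_image, MidL, GB_domain, mem_gband, mnE_f, mxE_f, Rat.cast_zero, Rat.cast_one,
      Rat.cast_div, Rat.cast_ofNat]
    constructor
    · rintro ⟨⟨h0, h0'⟩, h1, h2⟩
      refine ⟨![(1 - w 0 - w 1) / 2, (w 0 - w 1 + 1) / 2], ?_, ?_⟩
      · simp only [Matrix.cons_val_zero, Matrix.cons_val_one]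
        exact ⟨⟨by linarith, by linarith⟩, min_le_of_left_le (by linarith),
          le_max_of_le_right (by linarith)⟩
      · funext i; fin_cases i <;> simp <;> ring
    · rintro ⟨z, ⟨⟨h0, h0'⟩, h1, h2⟩, rfl⟩
      have hx : z 0 ≤ 1 - z 0 := by linarith
      rw [min_eq_left hx] at h1
      rw [max_eq_right hx] at h2
      simp only [Matrix.cons_val_zero, Matrix.cons_val_one]
      refine ⟨⟨?_, ?_⟩, ?_, ?_⟩ <;> linarith
  · have hz' := hz
    simp only [MidL, GB_domain, mem_gband, mnE_f, mxE_f, Rat.cast_zero, Rat.cast_one, Rat.cast_div,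
      Rat.cast_ofNat] at hz'
    have hx : z 0 ≤ 1 - z 0 := by linarith [hz'.1.2]
    rw [min_eq_left hx, max_eq_right hx] at hz'
    have hA := A10_den_pos (z := z) (by
      rw [cube_eq_sbDom, mem_sbDom, zeroE_f, oneE_f]
      exact ⟨⟨hz'.1.1, by linarith [hz'.1.2]⟩, by linarith [hz'.2.1, hz'.1.1],
        by linarith [hz'.2.2, hz'.1.1]⟩)
    have habs : |((!![-1, 1; -1, -1] : Matrix (Fin 2) (Fin 2) ℚ).det : ℝ)| = 2 := by
      rw [Matrix.det_fin_two_of]; norm_num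
    rw [habs, MidL, GB_integrand, Mid, loP_integrand, Rest, hiP_integrand, A10_integrand, H_integrand]
    simp only [Matrix.cons_val_zero, Matrix.cons_val_one]
    exact inv_eq_inv_mul_two hA (by push_cast; ring)

/-- (d7) `MidR ≡ H(1)` by `(x, y) ↦ (x − y, x + y − 1)`. -/
theorem d7 : KZ.of MidR - KZ.of (H 1 (by norm_num)) ∈ KZ.relations := by
  refine rel_affine MidR (H 1 (by norm_num)) !![1, -1; 1, 1] ![0, -1]
    (fun z => ![z 0 - z 1, z 0 + z 1 - 1]) (fun z i => by fin_cases i <;> simp <;> ring)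
    (by rw [Matrix.det_fin_two_of]; norm_num) ?_ fun z hz => ?_
  · ext w
    rw [mem_H_domain]
    simp only [mem_image, MidR, GB_domain, mem_gband, mnE_f, mxE_f, Rat.cast_one, Rat.cast_div,
      Rat.cast_ofNat]
    constructor
    · rintro ⟨⟨h0, h0'⟩, h1, h2⟩
      refine ⟨![(w 0 + w 1 + 1) / 2, (w 1 - w 0 + 1) / 2], ?_, ?_⟩
      · simp only [Matrix.cons_val_zero, Matrix.cons_val_one]
        exact ⟨⟨by linarith, by linarith⟩, min_le_of_right_le (by linarith),
          le_max_of_le_left (by linarith)⟩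
      · funext i; fin_cases i <;> simp <;> ring
    · rintro ⟨z, ⟨⟨h0, h0'⟩, h1, h2⟩, rfl⟩
      have hx : 1 - z 0 ≤ z 0 := by linarith
      rw [min_eq_right hx] at h1
      rw [max_eq_left hx] at h2
      simp only [Matrix.cons_val_zero, Matrix.cons_val_one]
      refine ⟨⟨?_, ?_⟩, ?_, ?_⟩ <;> linarith
  · have hz' := hz
    simp only [MidR, GB_domain, mem_gband, mnE_f, mxE_f, Rat.cast_one, Rat.cast_div,
      Rat.cast_ofNat] at hz'
    have hx : 1 - z 0 ≤ z 0 := by linarith [hz'.1.1]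
    rw [min_eq_right hx, max_eq_left hx] at hz'
    have hA := A10_den_pos (z := z) (by
      rw [cube_eq_sbDom, mem_sbDom, zeroE_f, oneE_f]
      exact ⟨⟨by linarith [hz'.1.1], hz'.1.2⟩, by linarith [hz'.2.1, hz'.1.2],
        by linarith [hz'.2.2, hz'.1.2]⟩)
    have habs : |((!![1, -1; 1, 1] : Matrix (Fin 2) (Fin 2) ℚ).det : ℝ)| = 2 := by
      rw [Matrix.det_fin_two_of]; norm_num
    rw [habs, MidR, GB_integrand, Mid, loP_integrand, Rest, hiP_integrand, A10_integrand, H_integrand]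
    simp only [Matrix.cons_val_zero, Matrix.cons_val_one]
    exact inv_eq_inv_mul_two hA (by push_cast; ring)

/-- (d8) `TΔ(c) ≡ H(c) + H(c)` (rule 1b on `Δ`). -/
theorem d8 (c : ℚ) (hc : -1 ≤ c ∧ c ≤ 1) :
    KZ.of (TΔ c hc) - KZ.of (H c hc) - KZ.of (H c hc) ∈ KZ.relations := by
  have hdom : (H c hc).domain = (TΔ c hc).domain := by
    rw [show (H c hc).domain = sbDom zeroE omE from rfl, show (TΔ c hc).domain = sbDom zeroE omE from rfl]
  refine KZ.integrandAddRel_subset_relations ⟨2, TΔ c hc, H c hc, H c hc, hdom, hdom, fun z hz => ?_, rfl⟩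
  have hz' : z ∈ sbDom zeroE omE := hz
  have hQ := PΔ_ge hc hz'
  simp only [PΔ, map_add, map_mul, map_one, aeval_C, aeval_X, eq_ratCast] at hQ
  rw [Pi.add_apply, H_integrand]
  simp only [TΔ, BRq_integrand, PΔ, map_add, map_mul, map_one, aeval_C, aeval_X, eq_ratCast]
  have hD : (1 : ℝ) + (c : ℝ) * z 0 * z 1 ≠ 0 := by linarith
  have hD' : (2 : ℝ) + 2 * (c : ℝ) * z 0 * z 1 ≠ 0 := by linarith
  rw [← add_div, div_eq_div_iff hD hD']
  ring

end Summit.KontsevichZagierPeriods.RootDecompQuadraticDescent.GoldenPair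

end
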